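import Mathlib.NumberTheory.JacobiSum.Basic
import Literature.NumberTheory.GaussSums.JacobiSumTeichmullerPadicProofs
import HarnessLib

/-!
# The finite model of the `χ_p`-twisting operator: Jacobi-sum eigen-relation, square
# relation, and the Stickelberger dichotomy of its coefficient

Route `TeichmullerTwistDescent` (D-0145 LINE 2), helper for the LINE-11 crux
`TwistedPeriodLatticeSaturation` (stmt-BirchSwinnertonDyer-25368, «K») and its parent
`OrdinaryLowValuationOptimalManinUnitGeEleven` (stmt-23885, Edixhoven's open case of Manin's
conjecture).  No summit, rung or crux is proved here; BSD is not proved by this file.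

## What this file is the finite shadow of

For `N = p²M`, `p ∤ M`, the twisting operator `T_χ := Σ_{a mod p, a ≠ 0} χ(a)·[1 a/p; 0 1]`
(`χ = χ_p` the quadratic character of conductor `p`) acts on `H₁(X₀(N), ℤ)`; on the `p²`-new part
`T_χ² = χ(−1)p`, and `Per_f ∘ T_χ = g(χ)·Per_{f⊗χ}`, so K («`Λ(f) = g(χ)Λ(f⊗χ)`») is the statement
that `T_χ` maps the `f_W`-isotypic sublattice ONTO the `f_V`-isotypic one (`V = W ⊗ χ`).  Under
`X₀(p²M) ≅ X(p; M)/T̃` (conjugation by `diag(p,1)`; `T̃` the diagonal torus of `GL₂(𝔽_p)`) the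
operator becomes `Σ_a χ(a)·u(a)`, `u(a) = [1 a; 0 1] ∈ GL₂(𝔽_p)`, acting on the tame principal-series
type `σ = Ind_B^{GL₂(𝔽_p)}(η ⊗ η⁻¹)` realised in functions on `ℙ¹(𝔽_p)`; the newvector lines of
`f_W` and `f_V` are the torus lines spanned by the functions `x ↦ η⁻¹(x)` and `x ↦ (η⁻¹χ)(x)` on
`𝔽_p ⊂ ℙ¹(𝔽_p)`.  The three theorems below are exactly the finite identities this uses:

* `sum_mul_apply_add` — **eigen-relation**: `Σ_a χ(a)·θ(x + a) = χ(−1)·J(θ, χ)·(θχ)(x)`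
  (the operator maps the `θ`-line to the `θχ`-line with coefficient a JACOBI SUM);
* `sum_smul_sum_smul_apply_add_add` — **square relation**: for `χ` quadratic and nontrivial and
  any function `φ` on the field with values in a module,
  `Σ_a χ(a) Σ_b χ(b) φ(x + a + b) = χ(−1)·(q·φ(x) − Σ_c φ(c))` (`q = #F`), i.e.
  `T_χ² = χ(−1)(q − U)` with `U` the total-sum (old-part) projector;
* `norm_jacobiSum_eq_one_of_half_lt` / `norm_jacobiSum_eq_inv_of_lt_half` — **the dichotomy**
  (Stickelberger, via the tree's `Literature.NumberTheory.GaussSums.norm_jacobiSum_eq_one_of_lt_add`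
  / `norm_jacobiSum_eq_inv_of_add_lt`): for `p`-adic Teichmüller powers `θ = ω^t`,
  `χ = ω^{(p−1)/2}` over `ℤ/p`: `‖J(θ, χ)‖_p = 1` if `t > (p−1)/2` and `= p⁻¹` if `t < (p−1)/2`.

With `θ = η⁻¹ = ω^{p−1−i}` for `η = ω^i` this reads: the operator is SATURATED on the function
lattice of `Ind(ω^i ⊗ ω^{−i})` iff `i < (p−1)/2`; for the optimal curve of Kodaira type II / III / IV
(resp. IV* / III* / II*) at `p` the relevant exponent is `i/(p−1) = ord_pΔ_min/12 ∈ {1/6, 1/4, 1/3}`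
(resp. `{2/3, 3/4, 5/6}`) — the «Stickelberger = Kodaira» coincidence of the route thesis, see the
seat memo `MECHANISM-K-lattice.md` (evidence on stmt-25368 / 23885).  Those identifications (Néron /
local-global) are NOT formalised here.

References: K. Ireland, M. Rosen, GTM 84, Ch. 8 §3 (Jacobi sums); S. Lang, *Cyclotomic Fields* I,
Ch. 1 §2 Thm. 2.1 (Stickelberger's congruence) — both already in the tree
(`Literature/NumberTheory/GaussSums/JacobiSumTeichmullerPadicProofs.lean`).
-/

noncomputable section

set_option linter.dupNamespace false

open Finset MulChar

namespace Summit.BirchSwinnertonDyer.BirchSwinnertonDyer.Theorems.TeichmullerTwistDescent.TwistOperatorFiniteModel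

section EigenRelation

variable {F : Type*} [Field F] [Fintype F] [DecidableEq F]
variable {R : Type*} [CommRing R] [IsDomain R]

omit [DecidableEq F] [IsDomain R] in
/-- **Eigen-relation of the twisting operator at a nonzero argument.**  For multiplicative
characters `χ, θ` of a finite field and `x ≠ 0`:
`Σ_a χ(a)·θ(x + a) = χ(−1)·J(θ, χ)·(θχ)(x)`, where `J(θ, χ) = Σ_z θ(z)χ(1 − z)` is Mathlib's
`jacobiSum θ χ` (substitute `a = x·z − x`).  [folklore; Ireland–Rosen Ch. 8 §3] -/
theorem sum_mul_apply_add_of_ne_zero (χ θ : MulChar F R) {x : F} (hx : x ≠ 0) :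
    ∑ a, χ a * θ (x + a) = χ (-1) * jacobiSum θ χ * (θ * χ) x := by
  -- reindex `a = x * z - x`
  let e : F ≃ F := (Equiv.mulLeft₀ x hx).trans (Equiv.subRight x)
  have he : ∀ z : F, e z = x * z - x := fun z => rfl
  rw [← Equiv.sum_comp e (fun a => χ a * θ (x + a))]
  have key : ∀ z : F, χ (e z) * θ (x + e z) = χ (-1) * (θ x * χ x) * (θ z * χ (1 - z)) := by
    intro z
    have h1 : x + e z = x * z := by rw [he]; ring
    have h2 : e z = (-1) * (x * (1 - z)) := by rw [he]; ring
    rw [h1, h2, map_mul, map_mul, map_mul]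
    ring
  simp_rw [key]
  rw [← mul_sum, jacobiSum, MulChar.coeToFun_mul, Pi.mul_apply]
  ring

/-- **Eigen-relation of the twisting operator** (all arguments).  If `θχ ≠ 1` then for every `x`:
`Σ_a χ(a)·θ(x + a) = χ(−1)·J(θ, χ)·(θχ)(x)` — at `x = 0` both sides vanish (a nontrivial character
sums to zero; `(θχ)(0) = 0`).  In the route's finite model: the `χ`-weighted unipotent average
`Σ_a χ(a)u(a)` maps the torus-line function `θ` of the tame type to the torus-line function `θχ`
with coefficient the Jacobi sum `J(θ, χ)` (up to the sign `χ(−1)`).  [folklore; Ireland–Rosen Ch. 8 §3] -/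
theorem sum_mul_apply_add (χ θ : MulChar F R) (hθχ : θ * χ ≠ 1) (x : F) :
    ∑ a, χ a * θ (x + a) = χ (-1) * jacobiSum θ χ * (θ * χ) x := by
  by_cases hx : x = 0
  · subst hx
    simp_rw [zero_add]
    have h0 : (θ * χ) (0 : F) = 0 := MulChar.map_nonunit _ not_isUnit_zero
    rw [h0, mul_zero]
    have : ∑ a, χ a * θ a = ∑ a, (θ * χ) a := by
      refine sum_congr rfl fun a _ => ?_
      rw [MulChar.coeToFun_mul, Pi.mul_apply, mul_comm]
    rw [this, MulChar.sum_eq_zero_of_ne_one hθχ]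
  · exact sum_mul_apply_add_of_ne_zero χ θ hx

end EigenRelation

section SquareRelation

variable {F : Type*} [Field F] [Fintype F] [DecidableEq F]
variable {R : Type*} [CommRing R] [IsDomain R]
variable {M : Type*} [AddCommGroup M] [Module R M]

omit [DecidableEq F] in
/-- The convolution square of a nontrivial quadratic character at a nonzero point:
`Σ_a χ(a)χ(c − a) = −χ(−1)` for `c ≠ 0` (it is `χ(c)²·J(χ, χ⁻¹) = J(χ, χ⁻¹) = −χ(−1)`,
Mathlib's `jacobiSum_nontrivial_inv`).  [folklore; Ireland–Rosen Ch. 8 §3] -/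
theorem sum_mul_apply_sub_of_ne_zero {χ : MulChar F R} (hχ : χ ≠ 1) (hq : χ.IsQuadratic)
    {c : F} (hc : c ≠ 0) :
    ∑ a, χ a * χ (c - a) = -χ (-1) := by
  have hinv : χ⁻¹ = χ := hq.inv
  -- reindex `a = c * z`
  rw [← Equiv.sum_comp (Equiv.mulLeft₀ c hc) (fun a => χ a * χ (c - a))]
  have key : ∀ z : F, χ (Equiv.mulLeft₀ c hc z) * χ (c - Equiv.mulLeft₀ c hc z) =
      (χ c * χ c) * (χ z * χ⁻¹ (1 - z)) := by
    intro z
    rw [hinv]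
    have h1 : c - Equiv.mulLeft₀ c hc z = c * (1 - z) := by simp [Equiv.mulLeft₀]; ring
    have h2 : (Equiv.mulLeft₀ c hc z : F) = c * z := rfl
    rw [h1, h2, map_mul, map_mul]
    ring
  simp_rw [key]
  rw [← mul_sum, ← jacobiSum, jacobiSum_nontrivial_inv hχ]
  have hcc : χ c * χ c = 1 := by
    rcases hq c with h | h | h
    · exact absurd h (MulChar.apply_ne_zero_iff.mpr (isUnit_iff_ne_zero.mpr hc))
    · rw [h, mul_one]
    · rw [h]; ring
  rw [hcc, one_mul]

/-- The convolution square of a nontrivial quadratic character at zero: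
`Σ_a χ(a)χ(−a) = χ(−1)·(q − 1)`, `q = #F`.  [folklore] -/
theorem sum_mul_apply_neg {χ : MulChar F R} (hq : χ.IsQuadratic) :
    ∑ a, χ a * χ (-a) = χ (-1) * (Fintype.card F - 1 : R) := by
  have key : ∀ a : F, χ a * χ (-a) = χ (-1) * (if a = 0 then 0 else 1) := by
    intro a
    by_cases ha : a = 0
    · subst ha
      rw [if_pos rfl, mul_zero, MulChar.map_nonunit _ not_isUnit_zero, zero_mul]
    · rw [if_neg ha, mul_one, show -a = (-1) * a by ring, map_mul]
      have haa : χ a * χ a = 1 := by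
        rcases hq a with h | h | h
        · exact absurd h (MulChar.apply_ne_zero_iff.mpr (isUnit_iff_ne_zero.mpr ha))
        · rw [h, mul_one]
        · rw [h]; ring
      calc χ a * (χ (-1) * χ a) = χ (-1) * (χ a * χ a) := by ring
        _ = χ (-1) := by rw [haa, mul_one]
  simp_rw [key]
  rw [← mul_sum]
  congr 1
  rw [sum_ite, sum_const_zero, zero_add, sum_const, nsmul_eq_mul, mul_one]
  have : (univ.filter fun a : F => ¬a = 0) = univ.erase 0 := by
    ext a; simp
  rw [this, card_erase_of_mem (mem_univ _), card_univ,
    Nat.cast_sub Fintype.card_pos, Nat.cast_one]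

/-- **Square relation of the twisting operator.**  For a nontrivial QUADRATIC character `χ` of a
finite field `F` (`q = #F`) and any function `φ : F → M` into an `R`-module:
`Σ_a χ(a) • Σ_b χ(b) • φ(x + a + b) = χ(−1) • (q • φ(x) − Σ_c φ(c))`.
In operator form `T_χ² = χ(−1)·(q − U)` where `(Uφ)(x) = Σ_c φ(c)` is the projector onto the
«old» (translation-invariant) part; on functions with `Uφ = 0` (the new part) `T_χ² = χ(−1)q`,
the finite shadow of `g(χ)² = χ(−1)p`.  [folklore] -/
theorem sum_smul_sum_smul_apply_add_add {χ : MulChar F R} (hχ : χ ≠ 1) (hq : χ.IsQuadratic)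
    (φ : F → M) (x : F) :
    ∑ a, χ a • ∑ b, χ b • φ (x + a + b) =
      χ (-1) • ((Fintype.card F : R) • φ x - ∑ c, φ c) := by
  -- Step 1: `Σ_a Σ_b χ(a)χ(b) φ(x+a+b) = Σ_c (Σ_a χ(a)χ(c−a)) φ(x+c)` (reindex `b = c − a`, swap).
  have step1 : ∑ a, χ a • ∑ b, χ b • φ (x + a + b) =
      ∑ c, (∑ a, χ a * χ (c - a)) • φ (x + c) := by
    have inner : ∀ a : F, χ a • ∑ b, χ b • φ (x + a + b) =
        ∑ c, (χ a * χ (c - a)) • φ (x + c) := by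
      intro a
      rw [← Equiv.sum_comp (Equiv.subRight a) (fun b => χ b • φ (x + a + b)), smul_sum]
      refine sum_congr rfl fun c _ => ?_
      rw [Equiv.subRight_apply, show x + a + (c - a) = x + c by ring, smul_smul]
    simp_rw [inner]
    rw [sum_comm]
    refine sum_congr rfl fun c _ => ?_
    rw [sum_smul]
  rw [step1]
  -- Step 2: evaluate the inner sums.
  have inner_val : ∀ c : F, ∑ a, χ a * χ (c - a) =
      if c = 0 then χ (-1) * (Fintype.card F - 1 : R) else -χ (-1) := by
    intro c
    by_cases hc : c = 0
    · subst hc; rw [if_pos rfl]; simp_rw [zero_sub]; exact sum_mul_apply_neg hq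
    · rw [if_neg hc, sum_mul_apply_sub_of_ne_zero hχ hq hc]
  simp_rw [inner_val]
  -- Step 3: split off `c = 0`.
  rw [← Finset.add_sum_erase univ _ (mem_univ (0 : F)), if_pos rfl, add_zero]
  have hrest : ∑ c ∈ univ.erase (0 : F),
      (if c = 0 then χ (-1) * (Fintype.card F - 1 : R) else -χ (-1)) • φ (x + c) =
      ∑ c ∈ univ.erase (0 : F), (-χ (-1)) • φ (x + c) := by
    refine sum_congr rfl fun c hc => ?_
    rw [if_neg (ne_of_mem_erase hc)]
  rw [hrest, ← smul_sum]
  have htot : ∑ c ∈ univ.erase (0 : F), φ (x + c) = ∑ c, φ c - φ x := by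
    have hall : ∑ c, φ (x + c) = ∑ c, φ c := Equiv.sum_comp (Equiv.addLeft x) φ
    have hsplit := Finset.add_sum_erase univ (fun c => φ (x + c)) (mem_univ (0 : F))
    rw [add_zero] at hsplit
    rw [eq_sub_iff_add_eq, add_comm, hsplit, hall]
  rw [htot]
  simp only [mul_smul, sub_smul, smul_sub, neg_smul, one_smul]
  abel

end SquareRelation

section Dichotomy

open Literature.NumberTheory.GaussSums

variable {p : ℕ} [hp : Fact p.Prime]

/-- **The Jacobi coefficient is a `p`-adic UNIT in the upper half.**  Let `θ, χ` be `ℚ_p`-valued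
characters of `ℤ/p` which are Teichmüller powers `θ ≡ a ↦ a^t`, `χ ≡ a ↦ a^{(p−1)/2}` (so `χ` is
the quadratic character), with `(p−1)/2 < t ≤ p − 2`.  Then `‖J(θ, χ)‖_p = 1`
(Stickelberger: `t + (p−1)/2 > p − 1`; the tree's `norm_jacobiSum_eq_one_of_lt_add`).
[cite: Lang1990, Ch. 1 §2 Thm. 2.1] -/
theorem norm_jacobiSum_eq_one_of_half_lt (hp2 : p ≠ 2) {θ χ : MulChar (ZMod p) ℚ_[p]} {t : ℕ}
    (ht : (p - 1) / 2 < t) (ht' : t ≤ p - 2)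
    (hθ : ∀ a : ZMod p, a ≠ 0 → ‖θ a - ((a.val : ℕ) : ℚ_[p]) ^ t‖ < 1)
    (hχ : ∀ a : ZMod p, a ≠ 0 → ‖χ a - ((a.val : ℕ) : ℚ_[p]) ^ ((p - 1) / 2)‖ < 1) :
    ‖jacobiSum θ χ‖ = 1 := by
  obtain ⟨k, hk⟩ := hp.out.odd_of_ne_two hp2
  have h2 := hp.out.two_le
  exact norm_jacobiSum_eq_one_of_lt_add ht' (by omega) (by omega) hθ hχ

/-- **The Jacobi coefficient has valuation one in the lower half.**  Same setting with
`1 ≤ t < (p−1)/2` and `θ, χ, θχ` nontrivial: `‖J(θ, χ)‖_p = p⁻¹`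
(Stickelberger: `t + (p−1)/2 < p − 1`, and `J·J' = p`; the tree's `norm_jacobiSum_eq_inv_of_add_lt`).
[cite: Lang1990, Ch. 1 §2 Thm. 2.1] -/
theorem norm_jacobiSum_eq_inv_of_lt_half {θ χ : MulChar (ZMod p) ℚ_[p]} {t : ℕ}
    (ht1 : 1 ≤ t) (ht : t < (p - 1) / 2)
    (hθ : ∀ a : ZMod p, a ≠ 0 → ‖θ a - ((a.val : ℕ) : ℚ_[p]) ^ t‖ < 1)
    (hχ : ∀ a : ZMod p, a ≠ 0 → ‖χ a - ((a.val : ℕ) : ℚ_[p]) ^ ((p - 1) / 2)‖ < 1)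
    (hθ1 : θ ≠ 1) (hχ1 : χ ≠ 1) (hθχ : θ * χ ≠ 1) :
    ‖jacobiSum θ χ‖ = (p : ℝ)⁻¹ :=
  norm_jacobiSum_eq_inv_of_add_lt ht1 (by omega) (by omega) hθ hχ hθ1 hχ1 hθχ

end Dichotomy

end Summit.BirchSwinnertonDyer.BirchSwinnertonDyer.Theorems.TeichmullerTwistDescent.TwistOperatorFiniteModel

end
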